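import Literature.AnabelianGeometry.AbsoluteAnabelian.GaloisCyclotome
import HarnessLib

/-!
# [AbsTopIII] Cor. 1.10 (i)(a): functoriality of `μ_{ℚ/ℤ}(G)` in isomorphisms of `G`

Mochizuki, *Topics in Absolute Anabelian Geometry III*, §1, Cor. 1.10 (i), manuscript pp. 41–42
(lit key `paper:url-5493eb38cbb7`): `μ_{ℚ/ℤ}(G_k) := lim_{→ H} (H^ab)_tors` (Verlagerung transition
maps) is constructed "'group-theoretically' from `G_k`"; "the asserted 'functoriality' is with
respect to arbitrary injective open homomorphisms of profinite groups" (p. 42).  This file proves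
the part of that functoriality which is TRANSPORT ALONG ISOMORPHISMS `e : G ≃ₜ* G'` (what is needed
to instantiate the abstract "Galois cyclotome" output structures of the abc-iut cell and to let `G`
act on `μ_{ℚ/ℤ}(G)` by conjugation — sibling file `GaloisCyclotomeAction.lean`):
`transfer_eq_prod_section` (the transfer via an arbitrary section of `G → G/H`),
`transfer_comp_mulEquiv` (the transfer commutes with group isomorphisms), `map_transfer`,
`comapEquiv` / `abelianizationCongr` / `verlagerung_comap` (compatibility of the Verlagerung of
`GaloisCyclotome.lean` with isomorphisms), and `muQZ.map`, `muQZ.map_refl`, `muQZ.map_trans`,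
`muQZ.map_symm_map`, `muQZ.congr e : μ_{ℚ/ℤ}(G) ≃+ μ_{ℚ/ℤ}(G')`.  Open injective homomorphisms that are
not bijective act "up to a factor given by the index" (Rmk. 1.10.1 (i) p. 44) — not typed here.
-/

noncomputable section

universe u v w

namespace Literature.AnabelianGeometry.AbsoluteAnabelian

/-! ### The transfer commutes with isomorphisms (pure group theory) -/

section TransferTransport

variable {G : Type u} [Group G] {G' : Type v} [Group G'] {A : Type w} [CommGroup A]

/-- Membership needed in `transfer_eq_prod_section`: for a section `σ` of `G → G/H`,
`σ(q)⁻¹ · g · σ(g⁻¹ q) ∈ H`. [cite: MochizukiAbsTopIII2015, Cor 1.10 (i) p.42] -/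
theorem section_inv_mul_mul_section_mem {H : Subgroup G} (σ : G ⧸ H → G)
    (hσ : ∀ q, (σ q : G ⧸ H) = q) (g : G) (q : G ⧸ H) :
    (σ q)⁻¹ * (g * σ (g⁻¹ • q)) ∈ H := by
  refine QuotientGroup.eq.mp ?_
  rw [hσ, ← smul_eq_mul, ← MulAction.Quotient.smul_coe, hσ, smul_inv_smul]

/-- The transfer computed with an arbitrary section `σ` of `G → G/H`:
`Ver(g) = ∏_{q ∈ G/H} ϕ(σ(q)⁻¹ · g · σ(g⁻¹ q))` ("the Verlagerung, or transfer, map", p. 42).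
[cite: MochizukiAbsTopIII2015, Cor 1.10 (i) p.42] -/
theorem transfer_eq_prod_section {H : Subgroup G} [H.FiniteIndex] [Fintype (G ⧸ H)] (ϕ : H →* A)
    (σ : G ⧸ H → G) (hσ : ∀ q, (σ q : G ⧸ H) = q) (g : G) :
    MonoidHom.transfer ϕ g =
      ∏ q : G ⧸ H, ϕ ⟨(σ q)⁻¹ * (g * σ (g⁻¹ • q)), section_inv_mul_mul_section_mem σ hσ g q⟩ := by
  let T : H.LeftTransversal := ⟨Set.range σ, Subgroup.isComplement_range_left hσ⟩
  rw [MonoidHom.transfer_def ϕ T g]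
  unfold Subgroup.leftTransversals.diff
  refine Finset.prod_congr (by convert rfl) fun q _ => congrArg ϕ (Subtype.ext ?_)
  show (T.2.leftQuotientEquiv q : G)⁻¹ * ((g • T).2.leftQuotientEquiv q : G) =
    (σ q)⁻¹ * (g * σ (g⁻¹ • q))
  rw [Subgroup.smul_apply_eq_smul_apply_inv_smul, smul_eq_mul,
    Subgroup.IsComplement.leftQuotientEquiv_apply hσ,
    Subgroup.IsComplement.leftQuotientEquiv_apply hσ]

/-- The transfer commutes with homomorphisms of the (commutative) coefficient group:
`f(Ver_ϕ(g)) = Ver_{f ∘ ϕ}(g)`. [cite: MochizukiAbsTopIII2015, Cor 1.10 (i) p.42] -/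
theorem map_transfer {B : Type*} [CommGroup B] {H : Subgroup G} [H.FiniteIndex] (ϕ : H →* A)
    (f : A →* B) (g : G) : f (MonoidHom.transfer ϕ g) = MonoidHom.transfer (f.comp ϕ) g := by
  letI : Fintype (G ⧸ H) := Fintype.ofFinite _
  rw [transfer_eq_prod_section ϕ Quotient.out Quotient.out_eq g,
    transfer_eq_prod_section (f.comp ϕ) Quotient.out Quotient.out_eq g, map_prod]
  rfl

/-- The preimage of a finite-index subgroup under a group isomorphism has finite index.
[cite: MochizukiAbsTopIII2015, Cor 1.10 (i) p.42] -/
theorem finiteIndex_comap_mulEquiv (e : G ≃* G') (H' : Subgroup G') [H'.FiniteIndex] :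
    (H'.comap (e : G →* G')).FiniteIndex :=
  ⟨by
    have h := Subgroup.index_comap_of_surjective (H := H') (f := (e : G →* G'))
      (fun y => ⟨e.symm y, e.apply_symm_apply y⟩)
    rw [h]
    exact Subgroup.FiniteIndex.index_ne_zero⟩

/-- **The transfer commutes with group isomorphisms**: for `e : G ≃* G'`, a finite-index
`H' ≤ G'` and `ϕ' : H' → A`, `Ver_{H'}(ϕ')(e g) = Ver_{e⁻¹H'}(ϕ' ∘ e)(g)` ("functorial
group-theoretic algorithm", p. 42). [cite: MochizukiAbsTopIII2015, Cor 1.10 (i) p.42] -/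
theorem transfer_comp_mulEquiv (e : G ≃* G') {H' : Subgroup G'} [H'.FiniteIndex]
    (ϕ' : H' →* A) (g : G) :
    haveI := finiteIndex_comap_mulEquiv e H'
    MonoidHom.transfer ϕ' (e g) =
      MonoidHom.transfer (ϕ'.comp ((e : G →* G').subgroupComap H')) g := by
  haveI := finiteIndex_comap_mulEquiv e H'
  set H := H'.comap (e : G →* G') with hH
  letI : Fintype (G' ⧸ H') := Fintype.ofFinite _
  letI : Fintype (G ⧸ H) := Fintype.ofFinite _
  -- the bijection on cosets induced by `e`
  let Q : G ⧸ H ≃ G' ⧸ H' := Quotient.congr e.toEquiv fun a b => by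
    rw [QuotientGroup.leftRel_apply, QuotientGroup.leftRel_apply]
    simp [H, Subgroup.mem_comap, map_mul, map_inv]
  have hQ : ∀ a : G, Q (a : G ⧸ H) = ((e a : G') : G' ⧸ H') := fun a => rfl
  have hQsmul : ∀ (x : G) (q : G ⧸ H), Q (x • q) = e x • Q q := by
    intro x q
    induction q using QuotientGroup.induction_on with
    | H a => rw [MulAction.Quotient.smul_coe, smul_eq_mul, hQ, hQ, map_mul,
        MulAction.Quotient.smul_coe, smul_eq_mul]
  let σ' : G' ⧸ H' → G' := Quotient.out
  have hσ' : ∀ q', (σ' q' : G' ⧸ H') = q' := Quotient.out_eq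
  let σ : G ⧸ H → G := fun q => e.symm (σ' (Q q))
  have heσ : ∀ q, e (σ q) = σ' (Q q) := fun q => e.apply_symm_apply _
  have hσ : ∀ q, (σ q : G ⧸ H) = q := by
    intro q
    apply Q.injective
    rw [hQ, heσ, hσ']
  rw [transfer_eq_prod_section ϕ' σ' hσ' (e g), transfer_eq_prod_section _ σ hσ g]
  symm
  refine Fintype.prod_equiv Q
    (fun q => (ϕ'.comp ((e : G →* G').subgroupComap H'))
      ⟨(σ q)⁻¹ * (g * σ (g⁻¹ • q)), section_inv_mul_mul_section_mem σ hσ g q⟩)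
    (fun q' => ϕ' ⟨(σ' q')⁻¹ * (e g * σ' ((e g)⁻¹ • q')),
      section_inv_mul_mul_section_mem σ' hσ' (e g) q'⟩)
    fun q => ?_
  rw [MonoidHom.comp_apply]
  refine congrArg ϕ' (Subtype.ext ?_)
  show e ((σ q)⁻¹ * (g * σ (g⁻¹ • q))) = (σ' (Q q))⁻¹ * (e g * σ' ((e g)⁻¹ • Q q))
  rw [map_mul, map_mul, map_inv, heσ, heσ, hQsmul, map_inv]

end TransferTransport

/-! ### Transport of the Verlagerung along `e : G ≃ₜ* G'` -/

section Topological

variable {G : Type u} [Group G] [TopologicalSpace G] [IsTopologicalGroup G]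
  {G' : Type v} [Group G'] [TopologicalSpace G'] [IsTopologicalGroup G']

omit [IsTopologicalGroup G] [IsTopologicalGroup G'] in
/-- `e⁻¹ y ∈ e⁻¹(U')` for `y ∈ U'`. [cite: MochizukiAbsTopIII2015, Cor 1.10 (i) p.42] -/
theorem symm_apply_mem_comap (e : G ≃ₜ* G') (U' : Subgroup G') (y : U') :
    e.symm y ∈ U'.comap (e : G →* G') := by
  rw [Subgroup.mem_comap, MonoidHom.coe_coe, ContinuousMulEquiv.apply_symm_apply]
  exact y.2

/-- The restriction `e⁻¹(U') ≃* U'` of `e` to a subgroup `U'` of `G'`, as a group isomorphism.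
[cite: MochizukiAbsTopIII2015, Cor 1.10 (i) p.42] -/
def comapMulEquiv (e : G ≃ₜ* G') (U' : Subgroup G') : U'.comap (e : G →* G') ≃* U' where
  toFun x := ⟨e x, x.2⟩
  invFun y := ⟨e.symm y, symm_apply_mem_comap e U' y⟩
  left_inv x := Subtype.ext (e.symm_apply_apply (x : G))
  right_inv y := Subtype.ext (e.apply_symm_apply (y : G'))
  map_mul' x y := Subtype.ext (map_mul e (x : G) (y : G))

/-- The restriction `e⁻¹(U') ≃ₜ* U'` of a bicontinuous isomorphism `e : G ≃ₜ* G'` to a subgroup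
`U'` of `G'`. [cite: MochizukiAbsTopIII2015, Cor 1.10 (i) p.42] -/
def comapEquiv (e : G ≃ₜ* G') (U' : Subgroup G') : U'.comap (e : G →* G') ≃ₜ* U' :=
  { comapMulEquiv e U' with
    continuous_toFun := (e.continuous.comp continuous_subtype_val).subtype_mk _
    continuous_invFun := (e.symm.continuous.comp continuous_subtype_val).subtype_mk _ }

omit [IsTopologicalGroup G] [IsTopologicalGroup G'] in
/-- `comapEquiv` on underlying elements is `e`. [cite: MochizukiAbsTopIII2015, Cor 1.10 (i) p.42] -/
@[simp] theorem coe_comapEquiv (e : G ≃ₜ* G') (U' : Subgroup G') (x : U'.comap (e : G →* G')) :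
    (comapEquiv e U' x : G') = e x := rfl

/-- A surjective homomorphism maps `[U, U]` onto `[U', U']`.
[cite: MochizukiAbsTopIII2015, Cor 1.10 (i) p.42] -/
private theorem map_commutator_of_surjective {U : Type u} [Group U] {U' : Type v} [Group U']
    (f : U →* U') (hf : Function.Surjective f) : (commutator U).map f = commutator U' := by
  rw [map_commutator_eq, MonoidHom.range_eq_top.mpr hf, ← commutator_def]

/-- A bicontinuous isomorphism maps the closure of `[U, U]` onto the closure of `[U', U']`.
[cite: MochizukiAbsTopIII2015, Cor 1.10 (i) p.42] -/
private theorem map_closure_commutator {U : Type u} [Group U] [TopologicalSpace U]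
    [IsTopologicalGroup U] {U' : Type v} [Group U'] [TopologicalSpace U'] [IsTopologicalGroup U']
    (e : U ≃ₜ* U') :
    ((commutator U).topologicalClosure).map (e.toMulEquiv : U →* U') =
      (commutator U').topologicalClosure := by
  apply SetLike.coe_injective
  rw [Subgroup.coe_map, Subgroup.topologicalClosure_coe, Subgroup.topologicalClosure_coe,
    ← congrArg SetLike.coe (map_commutator_of_surjective (e.toMulEquiv : U →* U') e.surjective),
    Subgroup.coe_map]
  exact e.toHomeomorph.image_closure (commutator U : Set U)

/-- The isomorphism of topological abelianizations `U^ab ⥲ U'^ab` induced by a bicontinuous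
isomorphism `U ≃ₜ* U'` ("the formation of `G^ab` [...] is functorial", [AbsTopI] §0 p. 8).
[cite: MochizukiAbsTopIII2015, Cor 1.10 (i) p.42] -/
def abelianizationCongr {U : Type u} [Group U] [TopologicalSpace U] [IsTopologicalGroup U]
    {U' : Type v} [Group U'] [TopologicalSpace U'] [IsTopologicalGroup U'] (e : U ≃ₜ* U') :
    TopologicalAbelianization U ≃* TopologicalAbelianization U' :=
  QuotientGroup.congr _ _ e.toMulEquiv (map_closure_commutator e)

/-- `abelianizationCongr e [u] = [e u]`. [cite: MochizukiAbsTopIII2015, Cor 1.10 (i) p.42] -/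
@[simp] theorem abelianizationCongr_mk {U : Type u} [Group U] [TopologicalSpace U]
    [IsTopologicalGroup U] {U' : Type v} [Group U'] [TopologicalSpace U'] [IsTopologicalGroup U']
    (e : U ≃ₜ* U') (u : U) :
    abelianizationCongr e (QuotientGroup.mk u) = QuotientGroup.mk (e u) := rfl

/-- `(abelianizationCongr e)⁻¹ [u'] = [e⁻¹ u']`. [cite: MochizukiAbsTopIII2015, Cor 1.10 (i) p.42] -/
@[simp] theorem abelianizationCongr_symm_mk {U : Type u} [Group U] [TopologicalSpace U]
    [IsTopologicalGroup U] {U' : Type v} [Group U'] [TopologicalSpace U'] [IsTopologicalGroup U']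
    (e : U ≃ₜ* U') (u' : U') :
    (abelianizationCongr e).symm (QuotientGroup.mk u') = QuotientGroup.mk (e.symm u') := rfl

variable [CompactSpace G] [CompactSpace G']

/-- **The Verlagerung is compatible with isomorphisms**: for `e : G ≃ₜ* G'` and open subgroups
`V' ≤ U'` of `G'`, the square formed by `Ver : (e⁻¹U')^ab → (e⁻¹V')^ab`, `Ver : U'^ab → V'^ab` and
the isomorphisms `abelianizationCongr` commutes. [cite: MochizukiAbsTopIII2015, Cor 1.10 (i) p.42] -/
theorem verlagerung_comap (e : G ≃ₜ* G') {U' V' : Subgroup G'} (hU' : IsOpen (U' : Set G'))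
    (hV' : IsOpen (V' : Set G')) (h' : V' ≤ U')
    (x : TopologicalAbelianization (U'.comap (e : G →* G'))) :
    abelianizationCongr (comapEquiv e V')
        (verlagerung (hU'.preimage e.continuous) (hV'.preimage e.continuous)
          (Subgroup.comap_mono h') x) =
      verlagerung hU' hV' h' (abelianizationCongr (comapEquiv e U') x) := by
  induction x using QuotientGroup.induction_on with
  | H u =>
    rw [abelianizationCongr_mk, verlagerung_mk, verlagerung_mk]
    haveI := finiteIndex_subgroupOf hU' hV'
    haveI := finiteIndex_subgroupOf (U := U'.comap (e : G →* G')) (V := V'.comap (e : G →* G'))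
      (hU'.preimage e.continuous) (hV'.preimage e.continuous)
    -- right-hand side: transport the transfer along `comapEquiv e U'`
    have hR := transfer_comp_mulEquiv (comapEquiv e U').toMulEquiv (toAbelianizationOfLe h') u
    -- left-hand side: push the transfer through `abelianizationCongr`
    have hL := map_transfer (toAbelianizationOfLe (Subgroup.comap_mono (f := (e : G →* G')) h'))
      (abelianizationCongr (comapEquiv e V')).toMonoidHom u
    change (abelianizationCongr (comapEquiv e V')).toMonoidHom
      (MonoidHom.transfer (toAbelianizationOfLe _) u) = MonoidHom.transfer _ ((comapEquiv e U') u)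
    rw [hL]
    erw [hR]
    congr 1

end Topological

/-! ### `μ_{ℚ/ℤ}` is functorial in isomorphisms -/

section Map

variable {G : Type u} [Group G] [TopologicalSpace G] [IsTopologicalGroup G] [CompactSpace G]
  {G' : Type u} [Group G'] [TopologicalSpace G'] [IsTopologicalGroup G'] [CompactSpace G']
  {G'' : Type u} [Group G''] [TopologicalSpace G''] [IsTopologicalGroup G''] [CompactSpace G'']

/-- The image `e(U) = (e⁻¹)⁻¹(U)` of an open subgroup under `e : G ≃ₜ* G'`, as an open subgroup
of `G'`. [cite: MochizukiAbsTopIII2015, Cor 1.10 (i) p.42] -/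
abbrev imageOpenSubgroup (e : G ≃ₜ* G') (U : OpenSubgroup G) : OpenSubgroup G' :=
  OpenSubgroup.comap (e.symm : G' →* G) e.symm.continuous U

omit [IsTopologicalGroup G] [CompactSpace G] [IsTopologicalGroup G'] [CompactSpace G'] in
/-- `e u ∈ e(U)` for `u ∈ U`. [cite: MochizukiAbsTopIII2015, Cor 1.10 (i) p.42] -/
theorem apply_mem_imageOpenSubgroup (e : G ≃ₜ* G') (U : OpenSubgroup G) {u : G} (hu : u ∈ U) :
    e u ∈ imageOpenSubgroup e U := by
  change e.symm (e u) ∈ U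
  rwa [e.symm_apply_apply]

/-- Transport of torsion classes `(U^ab)_tors → (e(U)^ab)_tors` along `e : G ≃ₜ* G'` (the
inverse of `abelianizationCongr (comapEquiv e.symm U)` on torsion).
[cite: MochizukiAbsTopIII2015, Cor 1.10 (i) p.42] -/
def torsionTransport (e : G ≃ₜ* G') (U : OpenSubgroup G) :
    abelianizationTorsion (U : Subgroup G) →*
      abelianizationTorsion ((imageOpenSubgroup e U : OpenSubgroup G') : Subgroup G') :=
  ((abelianizationCongr (comapEquiv e.symm (U : Subgroup G))).symm.toMonoidHom.restrict
      (abelianizationTorsion (U : Subgroup G))).codRestrict _ fun x =>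
    (CommGroup.mem_torsion _).mpr
      ((abelianizationCongr (comapEquiv e.symm (U : Subgroup G))).symm.toMonoidHom.isOfFinOrder
        ((CommGroup.mem_torsion _).mp x.2))

omit [CompactSpace G] [CompactSpace G'] in
/-- Underlying formula for `torsionTransport`. [cite: MochizukiAbsTopIII2015, Cor 1.10 (i) p.42] -/
@[simp] theorem coe_torsionTransport (e : G ≃ₜ* G') (U : OpenSubgroup G)
    (x : abelianizationTorsion (U : Subgroup G)) :
    (torsionTransport e U x).1 = (abelianizationCongr (comapEquiv e.symm (U : Subgroup G))).symm x.1 :=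
  rfl

omit [CompactSpace G] [CompactSpace G'] in
/-- `torsionTransport` on a representative: `[u] ↦ [e u]`.
[cite: MochizukiAbsTopIII2015, Cor 1.10 (i) p.42] -/
theorem coe_torsionTransport_mk (e : G ≃ₜ* G') (U : OpenSubgroup G) (u : (U : Subgroup G))
    (hx : (QuotientGroup.mk u : TopologicalAbelianization (U : Subgroup G)) ∈
      abelianizationTorsion (U : Subgroup G)) :
    (torsionTransport e U (⟨QuotientGroup.mk u, hx⟩ : abelianizationTorsion (U : Subgroup G))).1 =
      QuotientGroup.mk ⟨e u, apply_mem_imageOpenSubgroup e U u.2⟩ := by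
  rw [coe_torsionTransport]
  exact abelianizationCongr_symm_mk _ _

/-- Torsion transport is compatible with the Verlagerung.
[cite: MochizukiAbsTopIII2015, Cor 1.10 (i) p.42] -/
theorem torsionTransport_verlagerungTorsion (e : G ≃ₜ* G') {U V : OpenSubgroup G}
    (h : (V : Subgroup G) ≤ U) (x : abelianizationTorsion (U : Subgroup G)) :
    torsionTransport e V (verlagerungTorsion U.isOpen V.isOpen h x) =
      verlagerungTorsion (imageOpenSubgroup e U).isOpen (imageOpenSubgroup e V).isOpen
        (Subgroup.comap_mono h) (torsionTransport e U x) := by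
  apply Subtype.ext
  rw [coe_torsionTransport, coe_verlagerungTorsion, coe_verlagerungTorsion, coe_torsionTransport]
  have key := verlagerung_comap e.symm (U' := (U : Subgroup G)) (V' := (V : Subgroup G)) U.isOpen
    V.isOpen h ((abelianizationCongr (comapEquiv e.symm (U : Subgroup G))).symm x.1)
  rw [MulEquiv.apply_symm_apply] at key
  have key' := congrArg (abelianizationCongr (comapEquiv e.symm (V : Subgroup G))).symm key
  rw [MulEquiv.symm_apply_apply] at key'
  exact key'.symm

open scoped Classical in
/-- **`μ_{ℚ/ℤ}` is functorial in isomorphisms**: the homomorphism `μ_{ℚ/ℤ}(G) → μ_{ℚ/ℤ}(G')`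
induced by `e : G ≃ₜ* G'` (on `(U^ab)_tors` it is transport to `(e(U)^ab)_tors`).
[cite: MochizukiAbsTopIII2015, Cor 1.10 (i) p.42] -/
def muQZ.map (e : G ≃ₜ* G') : muQZ G →+ muQZ G' :=
  AddCommGroup.DirectLimit.lift _ _ _
    (fun U : (OpenSubgroup G)ᵒᵈ =>
      (muQZ.of (imageOpenSubgroup e (OrderDual.ofDual U))).comp
        (MonoidHom.toAdditive (torsionTransport e (OrderDual.ofDual U))))
    fun U V hUV x => by
      have hVU : ((OrderDual.ofDual V : OpenSubgroup G) : Subgroup G) ≤ OrderDual.ofDual U :=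
        OpenSubgroup.toSubgroup_le.mpr (OrderDual.ofDual_le_ofDual.mpr hUV)
      change muQZ.of _ (Additive.ofMul (torsionTransport e (OrderDual.ofDual V)
          (verlagerungTorsion _ _ hVU (Additive.toMul x)))) =
        muQZ.of _ (Additive.ofMul (torsionTransport e (OrderDual.ofDual U) (Additive.toMul x)))
      rw [torsionTransport_verlagerungTorsion e hVU (Additive.toMul x)]
      exact muQZ.of_verlagerung (OpenSubgroup.toSubgroup_le.mp (Subgroup.comap_mono hVU)) _

/-- `muQZ.map e` on the image of `(U^ab)_tors`. [cite: MochizukiAbsTopIII2015, Cor 1.10 (i) p.42] -/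
@[simp] theorem muQZ.map_of (e : G ≃ₜ* G') (U : OpenSubgroup G)
    (x : abelianizationTorsion (U : Subgroup G)) :
    muQZ.map e (muQZ.of U (Additive.ofMul x)) =
      muQZ.of (imageOpenSubgroup e U) (Additive.ofMul (torsionTransport e U x)) := by
  classical
  exact AddCommGroup.DirectLimit.lift_of _ _ _ _ _

/-- The structure map of `μ_{ℚ/ℤ}(G)` on a REPRESENTATIVE `u ∈ U ⊆ G` of a torsion class of
`U^ab` (bookkeeping device for the dependent index type of the direct limit).
[cite: MochizukiAbsTopIII2015, Cor 1.10 (i) p.41] -/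
def muQZ.ofRep (U : OpenSubgroup G) (u : G) (hu : u ∈ U)
    (ht : (QuotientGroup.mk (⟨u, hu⟩ : (U : Subgroup G)) :
      TopologicalAbelianization (U : Subgroup G)) ∈ abelianizationTorsion (U : Subgroup G)) :
    muQZ G :=
  muQZ.of U (Additive.ofMul ⟨_, ht⟩)

/-- `ofRep` only depends on the open subgroup and the representative.
[cite: MochizukiAbsTopIII2015, Cor 1.10 (i) p.41] -/
theorem muQZ.ofRep_congr {U U' : OpenSubgroup G} (hU : U = U') {u u' : G} (hu : u = u')
    {h₁ : u ∈ U} {t₁} {h₂ : u' ∈ U'} {t₂} :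
    muQZ.ofRep U u h₁ t₁ = muQZ.ofRep U' u' h₂ t₂ := by
  subst hU
  subst hu
  rfl

/-- Every element of `μ_{ℚ/ℤ}(G)` is an `ofRep`. [cite: MochizukiAbsTopIII2015, Cor 1.10 (i) p.41] -/
theorem muQZ.exists_ofRep (z : muQZ G) :
    ∃ (U : OpenSubgroup G) (u : G) (hu : u ∈ U) (ht : _), muQZ.ofRep U u hu ht = z := by
  obtain ⟨U, ⟨x, hx⟩, rfl⟩ := muQZ.exists_of z
  induction x using QuotientGroup.induction_on with
  | H u => exact ⟨U, u, u.2, hx, rfl⟩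

/-- `muQZ.map e` on representatives: `[u ∈ U] ↦ [e u ∈ e(U)]`.
[cite: MochizukiAbsTopIII2015, Cor 1.10 (i) p.42] -/
theorem muQZ.map_ofRep (e : G ≃ₜ* G') (U : OpenSubgroup G) (u : G) (hu : u ∈ U) (ht) :
    muQZ.map e (muQZ.ofRep U u hu ht) =
      muQZ.ofRep (imageOpenSubgroup e U) (e u) (apply_mem_imageOpenSubgroup e U hu)
        (by
          rw [← coe_torsionTransport_mk e U ⟨u, hu⟩ ht]
          exact (torsionTransport e U _).2) := by
  unfold muQZ.ofRep
  rw [muQZ.map_of]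
  congr 2

/-- `μ_{ℚ/ℤ}` transport along the identity is the identity.
[cite: MochizukiAbsTopIII2015, Cor 1.10 (i) p.42] -/
theorem muQZ.map_refl (z : muQZ G) : muQZ.map (ContinuousMulEquiv.refl G) z = z := by
  obtain ⟨U, u, hu, ht, rfl⟩ := muQZ.exists_ofRep z
  rw [muQZ.map_ofRep]
  exact muQZ.ofRep_congr (OpenSubgroup.ext fun _ => Iff.rfl) rfl

/-- `μ_{ℚ/ℤ}` transport is compatible with composition of isomorphisms.
[cite: MochizukiAbsTopIII2015, Cor 1.10 (i) p.42] -/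
theorem muQZ.map_trans (e : G ≃ₜ* G') (f : G' ≃ₜ* G'') (z : muQZ G) :
    muQZ.map (e.trans f) z = muQZ.map f (muQZ.map e z) := by
  obtain ⟨U, u, hu, ht, rfl⟩ := muQZ.exists_ofRep z
  rw [muQZ.map_ofRep, muQZ.map_ofRep, muQZ.map_ofRep]
  exact muQZ.ofRep_congr (OpenSubgroup.ext fun _ => Iff.rfl) rfl

/-- `μ_{ℚ/ℤ}` transport along `e⁻¹` inverts transport along `e`.
[cite: MochizukiAbsTopIII2015, Cor 1.10 (i) p.42] -/
theorem muQZ.map_symm_map (e : G ≃ₜ* G') (z : muQZ G) :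
    muQZ.map e.symm (muQZ.map e z) = z := by
  obtain ⟨U, u, hu, ht, rfl⟩ := muQZ.exists_ofRep z
  rw [muQZ.map_ofRep, muQZ.map_ofRep]
  exact muQZ.ofRep_congr (OpenSubgroup.ext fun g => by simp) (e.symm_apply_apply u)

/-- **`μ_{ℚ/ℤ}(G) ≅ μ_{ℚ/ℤ}(G')`** for isomorphic topological groups `e : G ≃ₜ* G'` ("recovered
group-theoretically" — an invariant of the isomorphism class of the profinite group).
[cite: MochizukiAbsTopIII2015, Cor 1.10 (i) p.42] -/
def muQZ.congr (e : G ≃ₜ* G') : muQZ G ≃+ muQZ G' where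
  toFun := muQZ.map e
  invFun := muQZ.map e.symm
  left_inv := muQZ.map_symm_map e
  right_inv z := by simpa using muQZ.map_symm_map e.symm z
  map_add' := map_add _

end Map

end Literature.AnabelianGeometry.AbsoluteAnabelian
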